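import Literature.AlgebraicGeometry.HodgeTheory.BettiUniverseAxioms
import Literature.AlgebraicGeometry.HodgeTheory.ComplexOrientationDegreeOne
import Literature.AlgebraicGeometry.HodgeTheory.ComplexGysinRational
import Literature.AlgebraicGeometry.Motives.ComplexPointsOrientation
import Literature.AlgebraicTopology.SingularHomology.PoincareDualityCorollaries
import Literature.AlgebraicTopology.SingularHomology.UniversalCoefficientsField
import Literature.AlgebraicTopology.SingularHomology.CohomologyOfPoint
import HarnessLib

/-!
# The trace pairing `(x, y) ↦ tr(x ∪ y)` of the light Betti–Hodge universe: Poincaré duality over `ℚ`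
# and invariance under automorphisms (proved; no named fact)

Family `hodge`, layer `Literature/AlgebraicGeometry/HodgeTheory`. Written by the cross-ladder
literature-typing seat `littype-FH1-2` (cell `hodge-nonav`) for the routes
`HodgeConjecture/SignSymmetricPowers` and `HodgeConjecture/CyclicUnitaryPowers`, whose cruxes are typed
over the LIGHT Betti–Hodge universe of `BettiUniverseAxioms` — `pull σ k = σ^*` on `Hᵏ(X(ℂ); ℚ)`,
`cup X i j`, and the light trace `tr hX k` (the coordinate along a chosen generator of the line
`H²ⁿ(X(ℂ); ℚ)`, zero off the top degree) — and consume, as hypotheses of landed algebra, exactly the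
two facts proved here:

* crux K1 `VeryGeneralSignCommutatorsInHg`, clauses (i)–(ii) of its "sign deck": for the involution
  `σ` of `X`, `pull σ 3 ^ 2 = 1` and `tr hX (3 + 3) (cup X 3 3 (pull σ 3 x) (pull σ 3 y)) = tr hX (3 + 3) (cup X 3 3 x y)`
  (`pull_sq_eq_one_of_comp_self_eq_id`, `tr_cup_pull_pull`);
* crux K2 `PowersHodgeOfSignCommutators`, step (A2) of the cell's assembly map
  (`Literature.LinearAlgebra.Alternating.mem_of_forall_commutator_mem`, hypothesis `hBn`): the bilinear
  form `B := LinearMap.compr₂ (cup X 3 3) (tr hX (3 + 3))` on `H³(X(ℂ); ℚ)` is `Nondegenerate`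
  (`nondegenerate_tr_cup`, the case `n = 3` of Poincaré duality).

## Contents (everything PROVED from the tree; no definition, no named fact — D-0026)

§1 `finrank_bettiCohomology_top`: `dim_ℚ H²ⁿ(X(ℂ); ℚ) = 1` for `X` smooth projective of dimension `n`
   (Poincaré duality symmetry of Betti numbers, the tree's `Motives.ComplexPoints.finrank_singularCohomology_eq_of_add_eq`,
   and `H⁰ = ℚ` of the path-connected manifold `X(ℂ)`; Hatcher Cor. 3.37, SGA1 XII 2.4); hence the light
   trace is non-zero and INJECTIVE on the top degree (`tr_top_ne_zero`, `tr_top_injective`).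
§2 **Poincaré duality for the trace pairing over `ℚ`** (Hatcher Prop. 3.38 for the closed `ℚ`-oriented
   `2n`-manifold `X(ℂ)`, PROVED in the tree as `isPerfPair_cupPairing_of_field_holds` for the pairing
   `⟨x ∪ y, [X(ℂ)]_ν⟩` of any `ℚ`-orientation `ν`; transferred to `tr`, which is injective on the line
   `H²ⁿ`): `eq_zero_of_forall_tr_cup_eq_zero` (left), `eq_zero_of_forall_tr_cup_eq_zero'` (right),
   `separatingLeft_tr_cup`, `separatingRight_tr_cup`, and in the middle degree the bilinear form
   `LinearMap.compr₂ (cup X n n) (tr hX (n + n))` is `Nondegenerate` (`nondegenerate_tr_cup`).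
§3 **An automorphism acts as the identity on `H²ⁿ(X(ℂ); ℚ)`** (`pull_top_apply_of_isIso`,
   `pull_top_eq_id_of_isIso`): an isomorphism is birational, so it has degree `+1` for the rational
   complex orientations (Fulton Lemma 19.1.2 / Milnor–Stasheff §13, the tree's
   `hasDegree_one_complexOrientationRat_of_isBirational`: `σ(ℂ)_*[X(ℂ)] = [X(ℂ)]`); since
   `H₂ₙ(X(ℂ); ℚ) = ℚ · [X(ℂ)]` (Hatcher Thm. 3.26, `exists_eq_smul_fundamentalClass_of_connectedSpace`) and
   the Kronecker map is injective over a field (Hatcher Thm. 3.2, `kroneckerPairing_injective_of_field`),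
   `⟨σ^* z, c⟩ = ⟨z, σ_* c⟩ = ⟨z, c⟩` for all `c` gives `σ^* z = z`. Consequences: `tr ∘ σ^* = tr` in
   every degree (`tr_comp_pull_of_isIso`, `tr_pull_of_isIso`) and **`σ^*` is an isometry of the trace
   pairing**: `tr(σ^*x ∪ σ^*y) = tr(x ∪ y)` (`tr_cup_pull_pull_of_isIso`).
§4 Involutions and finite-order bookkeeping: `σ ≫ τ = 𝟙 ⇒ σ^* ∘ τ^* = id`
   (`pull_comp_pull_of_comp_eq_id`), an involution `σ ≫ σ = 𝟙 X` has `(σ^*)² = 1` in `Module.End ℚ Hᵏ` (`pull_sq_eq_one_of_comp_self_eq_id`)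
   and is a trace isometry (`tr_cup_pull_pull`, the two K1 deck clauses with no `IsIso` instance to supply).

Printed sources. Hatcher, *Algebraic Topology* (2002) §3.3: Thm. 3.26 (top homology of a closed
connected oriented manifold), Thm. 3.30 (Poincaré duality), Prop. 3.38 ("The cup product pairing is
nonsingular for closed `R`-orientable manifolds when `R` is a field"), §2.2/§3.3 p. 233 ff. (degree).
Fulton, *Intersection Theory* Lemma 19.1.2 with §1.4 (`f_*[X'] = deg(X'/X)[X]`, degree `1` for
birational `f`); Milnor–Stasheff §13 p. 151 (holomorphic maps preserve the complex orientation).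
Voisin, *Hodge Theory I* §7.1.2 (the intersection form `⟨α, β⟩ = ∫_X α ∪ β` is non-degenerate by
Poincaré duality) — here for the light trace, a non-zero rational multiple of `∫_X`.

## References

* [HatcherAT2002] A. Hatcher, Algebraic Topology, CUP 2002, §3.1 Thm. 3.2, §3.3 Thm. 3.26, Thm. 3.30,
  Cor. 3.37, Prop. 3.38.
* [Fulton1998] W. Fulton, Intersection Theory, 2nd ed., Springer 1998, §1.4 and Lemma 19.1.2.
* [MilnorStasheff1974] J. Milnor, J. Stasheff, Characteristic Classes, PUP 1974, §13 p. 151.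
* [VoisinHodgeI2002] C. Voisin, Hodge Theory and Complex Algebraic Geometry I, CUP 2002, §7.1.2,
  §11.1.2.
* [SGA1] A. Grothendieck, SGA 1, Exp. XII Prop. 2.4 (connectedness of `X(ℂ)`).
-/

noncomputable section

open CategoryTheory Module
open Literature.AlgebraicTopology.SingularHomology
open Literature.AlgebraicGeometry.Motives (bettiCohomology bettiCup IsSmoothProjective ComplexPoints)

namespace Literature.AlgebraicGeometry.HodgeTheory

namespace BettiUniverse

section HodgeTheory

variable {n : ℕ} {X : Motives.SchemeOver ℂ}

/-! ### §1 The top degree `H²ⁿ(X(ℂ); ℚ)` is a line; the light trace is injective there -/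

/-- **`dim_ℚ H²ⁿ(X(ℂ); ℚ) = 1`** for `X` smooth projective of dimension `n`: `b_{2n} = b_0`
(Poincaré duality for the closed `ℚ`-oriented `2n`-manifold `X(ℂ)`, Hatcher Cor. 3.37) and
`H⁰(X(ℂ); ℚ) = ℚ` (`X(ℂ)` is path connected: connected by SGA1 XII 2.4 and locally path connected as
a manifold). [cite: HatcherAT2002, §3.3 Cor. 3.37] [cite: SGA1, Exp. XII Prop. 2.4] -/
theorem finrank_bettiCohomology_top (hX : IsSmoothProjective n X) :
    finrank ℚ (bettiCohomology X (2 * n)) = 1 := by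
  letI := hX.chartedSpace
  haveI := connectedSpace_complexPoints hX
  haveI : LocallyPathConnectedSpace (ComplexPoints X) :=
    ChartedSpace.locallyPathConnectedSpace (EuclideanSpace ℝ (Fin (2 * n))) (ComplexPoints X)
  haveI : PathConnectedSpace (ComplexPoints X) := pathConnectedSpace_iff_connectedSpace.mpr ‹_›
  change finrank ℚ (singularCohomology ℚ ℚ (ComplexPoints X) (2 * n)) = 1
  rw [Motives.ComplexPoints.finrank_singularCohomology_eq_of_add_eq ℚ hX
    (show 2 * n + 0 = 2 * n by omega),
    (singularCohomologyZeroEquiv ℚ ℚ (ComplexPoints X)).finrank_eq, Module.finrank_self]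

/-- The light trace is non-zero on the top degree (no hypothesis on `dim H²ⁿ` left).
[cite: HatcherAT2002, §3.3 Cor. 3.37] -/
theorem tr_top_ne_zero (hX : IsSmoothProjective n X) : tr hX (2 * n) ≠ 0 :=
  tr_ne_zero hX (finrank_bettiCohomology_top hX)

/-- A non-zero linear functional on a line is injective. [folklore] -/
private theorem injective_of_finrank_eq_one_of_ne_zero {K V : Type*} [Field K] [AddCommGroup V] [Module K V]
    (h1 : finrank K V = 1) {ψ : V →ₗ[K] K} (hψ : ψ ≠ 0) : Function.Injective ψ := by
  obtain ⟨v, hv⟩ := DFunLike.ne_iff.1 hψ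
  rw [LinearMap.zero_apply] at hv
  have hv0 : v ≠ 0 := fun h ↦ hv (by rw [h, map_zero])
  rw [← LinearMap.ker_eq_bot, Submodule.eq_bot_iff]
  intro w hw
  obtain ⟨a, rfl⟩ := (finrank_eq_one_iff_of_nonzero' v hv0).1 h1 w
  rw [LinearMap.mem_ker, map_smul, smul_eq_mul, mul_eq_zero] at hw
  rcases hw with ha | hψv
  · rw [ha, zero_smul]
  · exact absurd hψv hv

/-- **The light trace is injective on `H²ⁿ(X(ℂ); ℚ)`**: `tr hX (2n) z = 0 ↔ z = 0`. [cite: HatcherAT2002, §3.3 Cor. 3.37] -/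
theorem tr_top_injective (hX : IsSmoothProjective n X) : Function.Injective (tr hX (2 * n)) :=
  injective_of_finrank_eq_one_of_ne_zero (finrank_bettiCohomology_top hX) (tr_top_ne_zero hX)

/-- `tr hX (2n) z = 0 ↔ z = 0`. [cite: HatcherAT2002, §3.3 Cor. 3.37] -/
theorem tr_top_eq_zero_iff (hX : IsSmoothProjective n X) (z : bettiCohomology X (2 * n)) :
    tr hX (2 * n) z = 0 ↔ z = 0 :=
  ⟨fun h ↦ tr_top_injective hX (by rw [h, map_zero]), fun h ↦ by rw [h, map_zero]⟩

/-! ### §2 Poincaré duality for the trace pairing over `ℚ` -/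

/-- Auxiliary form of Poincaré duality with the top degree a variable (`m = 2n`), for the cup product
`bettiCup hkl : Hᵏ → Hˡ → Hᵐ`: if `tr(x ∪ y) = 0` for all `y` then `x = 0`. The cup pairing
`⟨x ∪ y, [X(ℂ)]_ν⟩` of a `ℚ`-orientation `ν` is perfect (Hatcher Prop. 3.38, the tree's
`isPerfPair_cupPairing_of_field_holds`), and `tr` vanishes only at `0` on `H²ⁿ`. [cite: HatcherAT2002, §3.3 Prop. 3.38] -/
theorem eq_zero_of_forall_tr_bettiCup_eq_zero (hX : IsSmoothProjective n X) {k l m : ℕ}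
    (hkl : k + l = m) (hm : m = 2 * n) {x : bettiCohomology X k}
    (hx : ∀ y : bettiCohomology X l, tr hX m (bettiCup hkl x y) = 0) : x = 0 := by
  subst hm
  letI := hX.chartedSpace
  haveI := Motives.ComplexPoints.compactSpace_of_isSmoothProjective hX
  haveI := Motives.ComplexPoints.t2Space_of_isSmoothProjective hX
  let ν : HomologicalOrientation ℚ (ComplexPoints X) (2 * n) :=
    Classical.choice (Motives.ComplexPoints.isOrientableOver ℚ hX)
  have hP : (cupPairing ν hkl).IsPerfPair := isPerfPair_cupPairing_of_field_holds
  refine hP.bijective_left.1 ?_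
  rw [map_zero]
  refine LinearMap.ext fun y ↦ ?_
  have h0 : bettiCup hkl x y = 0 := (tr_top_eq_zero_iff hX _).1 (hx y)
  rw [LinearMap.zero_apply, cupPairing_apply]
  change kroneckerPairing ℚ ℚ (ComplexPoints X) (2 * n) (bettiCup hkl x y) ν.fundamentalClass = 0
  rw [h0, map_zero, LinearMap.zero_apply]

/-- The same on the right: if `tr(x ∪ y) = 0` for all `x` then `y = 0`. [cite: HatcherAT2002, §3.3 Prop. 3.38] -/
theorem eq_zero_of_forall_tr_bettiCup_eq_zero' (hX : IsSmoothProjective n X) {k l m : ℕ}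
    (hkl : k + l = m) (hm : m = 2 * n) {y : bettiCohomology X l}
    (hy : ∀ x : bettiCohomology X k, tr hX m (bettiCup hkl x y) = 0) : y = 0 := by
  subst hm
  letI := hX.chartedSpace
  haveI := Motives.ComplexPoints.compactSpace_of_isSmoothProjective hX
  haveI := Motives.ComplexPoints.t2Space_of_isSmoothProjective hX
  let ν : HomologicalOrientation ℚ (ComplexPoints X) (2 * n) :=
    Classical.choice (Motives.ComplexPoints.isOrientableOver ℚ hX)
  have hP : (cupPairing ν hkl).IsPerfPair := isPerfPair_cupPairing_of_field_holds
  refine hP.bijective_right.1 ?_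
  rw [map_zero]
  refine LinearMap.ext fun x ↦ ?_
  have h0 : bettiCup hkl x y = 0 := (tr_top_eq_zero_iff hX _).1 (hy x)
  rw [LinearMap.zero_apply, LinearMap.flip_apply, cupPairing_apply]
  change kroneckerPairing ℚ ℚ (ComplexPoints X) (2 * n) (bettiCup hkl x y) ν.fundamentalClass = 0
  rw [h0, map_zero, LinearMap.zero_apply]

/-- **Poincaré duality for the trace pairing, left form**: for `X` smooth projective of dimension
`n`, `k + l = 2n` and `x ∈ Hᵏ(X(ℂ); ℚ)`, if `tr(x ∪ y) = 0` for every `y ∈ Hˡ(X(ℂ); ℚ)` then `x = 0`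
("the cup product pairing is nonsingular for closed `R`-orientable manifolds when `R` is a field";
Voisin I §7.1.2: the intersection form is non-degenerate). [cite: HatcherAT2002, §3.3 Prop. 3.38]
[cite: VoisinHodgeI2002, §7.1.2] -/
theorem eq_zero_of_forall_tr_cup_eq_zero (hX : IsSmoothProjective n X) {k l : ℕ} (h : k + l = 2 * n)
    {x : bettiCohomology X k} (hx : ∀ y : bettiCohomology X l, tr hX (k + l) (cup X k l x y) = 0) :
    x = 0 :=
  eq_zero_of_forall_tr_bettiCup_eq_zero hX rfl h hx

/-- **Poincaré duality for the trace pairing, right form**: if `tr(x ∪ y) = 0` for every `x` then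
`y = 0` (`k + l = 2n`). [cite: HatcherAT2002, §3.3 Prop. 3.38] -/
theorem eq_zero_of_forall_tr_cup_eq_zero' (hX : IsSmoothProjective n X) {k l : ℕ} (h : k + l = 2 * n)
    {y : bettiCohomology X l} (hy : ∀ x : bettiCohomology X k, tr hX (k + l) (cup X k l x y) = 0) :
    y = 0 :=
  eq_zero_of_forall_tr_bettiCup_eq_zero' hX rfl h hy

/-- The trace pairing `(x, y) ↦ tr(x ∪ y)`, `Hᵏ × Hˡ → ℚ`, `k + l = 2n`, is left-separating.
[cite: HatcherAT2002, §3.3 Prop. 3.38] -/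
theorem separatingLeft_tr_cup (hX : IsSmoothProjective n X) {k l : ℕ} (h : k + l = 2 * n) :
    (LinearMap.compr₂ (cup X k l) (tr hX (k + l))).SeparatingLeft :=
  fun _ hx ↦ eq_zero_of_forall_tr_cup_eq_zero hX h fun y ↦ by simpa using hx y

/-- The trace pairing `(x, y) ↦ tr(x ∪ y)`, `Hᵏ × Hˡ → ℚ`, `k + l = 2n`, is right-separating.
[cite: HatcherAT2002, §3.3 Prop. 3.38] -/
theorem separatingRight_tr_cup (hX : IsSmoothProjective n X) {k l : ℕ} (h : k + l = 2 * n) :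
    (LinearMap.compr₂ (cup X k l) (tr hX (k + l))).SeparatingRight :=
  fun _ hy ↦ eq_zero_of_forall_tr_cup_eq_zero' hX h fun x ↦ by simpa using hy x

/-- **The middle-degree trace form is non-degenerate**: for `X` smooth projective of dimension `n`
the bilinear form `(x, y) ↦ tr(x ∪ y)` on `Hⁿ(X(ℂ); ℚ)` — `LinearMap.compr₂ (cup X n n) (tr hX (n + n))`,
the `B` of the routes' `Cen`/`Comm` clauses at `n = 3` — is `Nondegenerate` (Poincaré duality over
`ℚ`). This is the hypothesis `hBn` of
`Literature.LinearAlgebra.Alternating.mem_of_forall_commutator_mem` in the K2 assembly.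
[cite: HatcherAT2002, §3.3 Prop. 3.38] [cite: VoisinHodgeI2002, §7.1.2] -/
theorem nondegenerate_tr_cup (hX : IsSmoothProjective n X) :
    (LinearMap.compr₂ (cup X n n) (tr hX (n + n))).Nondegenerate :=
  ⟨separatingLeft_tr_cup hX (two_mul n).symm, separatingRight_tr_cup hX (two_mul n).symm⟩

/-- Existence form of the left duality: a non-zero `x ∈ Hᵏ(X(ℂ); ℚ)` has a partner `y ∈ Hˡ`,
`k + l = 2n`, with `tr(x ∪ y) ≠ 0`. [cite: HatcherAT2002, §3.3 Prop. 3.38] -/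
theorem exists_tr_cup_ne_zero (hX : IsSmoothProjective n X) {k l : ℕ} (h : k + l = 2 * n)
    {x : bettiCohomology X k} (hx : x ≠ 0) :
    ∃ y : bettiCohomology X l, tr hX (k + l) (cup X k l x y) ≠ 0 := by
  by_contra hall
  exact hx (eq_zero_of_forall_tr_cup_eq_zero hX h fun y ↦
    not_ne_iff.mp fun hne ↦ hall ⟨y, hne⟩)

/-! ### §3 An automorphism acts as the identity on the top degree; the trace pairing is invariant -/

/-- **An automorphism of a smooth projective variety acts as the identity on `H²ⁿ(X(ℂ); ℚ)`.** For
`σ : X ⟶ X` over `ℂ` with `σ.left` an isomorphism of schemes and `z ∈ H²ⁿ(X(ℂ); ℚ)`, `σ^* z = z`: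
`σ` is birational, hence of degree `+1` for the rational complex orientation
(`hasDegree_one_complexOrientationRat_of_isBirational`: `σ(ℂ)_*[X(ℂ)] = [X(ℂ)]`), every class of
`H₂ₙ(X(ℂ); ℚ)` is a multiple of `[X(ℂ)]` (Hatcher Thm. 3.26), and the Kronecker map
`H²ⁿ → Hom(H₂ₙ, ℚ)` is injective (Hatcher Thm. 3.2), while `⟨σ^* z, c⟩ = ⟨z, σ(ℂ)_* c⟩`.
[cite: Fulton1998, Lemma 19.1.2 and §1.4] [cite: HatcherAT2002, §3.3 Thm. 3.26 and §3.1 Thm. 3.2] -/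
theorem pull_top_apply_of_isIso (hX : IsSmoothProjective n X) (σ : X ⟶ X) [IsIso σ.left]
    (z : bettiCohomology X (2 * n)) : pull σ (2 * n) z = z := by
  letI := hX.chartedSpace
  haveI := Motives.ComplexPoints.compactSpace_of_isSmoothProjective hX
  haveI := Motives.ComplexPoints.t2Space_of_isSmoothProjective hX
  haveI := connectedSpace_complexPoints hX
  have hbir : Resolution.IsBirational σ.left := ⟨⊤, by simp, by simp, inferInstance⟩
  have hdeg := hasDegree_one_complexOrientationRat_of_isBirational hX hX σ hbir
  rw [HasDegree, one_smul] at hdeg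
  apply kroneckerPairing_injective_of_field ℚ (ComplexPoints X) (2 * n)
  refine LinearMap.ext fun c ↦ ?_
  obtain ⟨a, rfl⟩ := exists_eq_smul_fundamentalClass_of_connectedSpace (complexOrientationRat hX) c
  rw [map_smul, map_smul]
  congr 1
  change kroneckerPairing ℚ ℚ (ComplexPoints X) (2 * n)
      (singularCohomology.map ℚ ℚ (Motives.AlgPoints.mapContinuous (L := ℂ) σ) (2 * n) z)
      (complexOrientationRat hX).fundamentalClass = _
  rw [kroneckerPairing_map, hdeg]

/-- `σ^* = id` on `H²ⁿ(X(ℂ); ℚ)` for an automorphism `σ`. [cite: Fulton1998, Lemma 19.1.2 and §1.4]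
[cite: HatcherAT2002, §3.3 Thm. 3.26] -/
theorem pull_top_eq_id_of_isIso (hX : IsSmoothProjective n X) (σ : X ⟶ X) [IsIso σ.left] :
    pull σ (2 * n) = LinearMap.id :=
  LinearMap.ext (pull_top_apply_of_isIso hX σ)

/-- **The light trace is invariant under automorphisms**: `tr ∘ σ^* = tr` in every degree (the top
degree by `pull_top_eq_id_of_isIso`; elsewhere `tr = 0`). [cite: Fulton1998, Lemma 19.1.2 and §1.4] -/
theorem tr_comp_pull_of_isIso (hX : IsSmoothProjective n X) (σ : X ⟶ X) [IsIso σ.left] (k : ℕ) :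
    tr hX k ∘ₗ pull σ k = tr hX k := by
  by_cases hk : k = 2 * n
  · subst hk
    rw [pull_top_eq_id_of_isIso hX σ, LinearMap.comp_id]
  · rw [tr_of_ne hX hk, LinearMap.zero_comp]

/-- `tr(σ^* z) = tr(z)` for an automorphism `σ`, every degree. [cite: Fulton1998, Lemma 19.1.2 and §1.4] -/
theorem tr_pull_of_isIso (hX : IsSmoothProjective n X) (σ : X ⟶ X) [IsIso σ.left] (k : ℕ)
    (z : bettiCohomology X k) : tr hX k (pull σ k z) = tr hX k z := by
  rw [← LinearMap.comp_apply, tr_comp_pull_of_isIso hX σ k]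

/-- **An automorphism is an isometry of the trace pairing**: `tr(σ^*x ∪ σ^*y) = tr(x ∪ y)` for all
degrees `i, j` (`σ^*` is multiplicative, Hatcher Prop. 3.10, and fixes the trace). For `i = j = 3` on a
threefold this is clause (ii) of the sign deck of `SignSymmetricPowers.VeryGeneralSignCommutatorsInHg`.
[cite: HatcherAT2002, §3.2 Prop. 3.10] [cite: Fulton1998, Lemma 19.1.2 and §1.4] -/
theorem tr_cup_pull_pull_of_isIso (hX : IsSmoothProjective n X) (σ : X ⟶ X) [IsIso σ.left]
    (i j : ℕ) (x : bettiCohomology X i) (y : bettiCohomology X j) :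
    tr hX (i + j) (cup X i j (pull σ i x) (pull σ j y)) = tr hX (i + j) (cup X i j x y) := by
  rw [← pull_cup, tr_pull_of_isIso hX σ]

/-! ### §4 Involutions and mutually inverse pairs -/

/-- `σ ≫ τ = 𝟙 X ⇒ σ^* ∘ τ^* = id` on `Hᵏ(X(ℂ); ℚ)` (contravariance: `(σ ≫ τ)^* = σ^* ∘ τ^*`).
[cite: HatcherAT2002, §3.1 p. 198] -/
theorem pull_comp_pull_of_comp_eq_id {σ τ : X ⟶ X} (h : σ ≫ τ = 𝟙 X) (k : ℕ) :
    pull σ k ∘ₗ pull τ k = LinearMap.id := by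
  rw [← pull_comp, h, pull_id]

/-- `σ ≫ τ = 𝟙 X ⇒ σ^*(τ^* z) = z`. [cite: HatcherAT2002, §3.1 p. 198] -/
theorem pull_pull_apply_of_comp_eq_id {σ τ : X ⟶ X} (h : σ ≫ τ = 𝟙 X) (k : ℕ) (z : bettiCohomology X k) :
    pull σ k (pull τ k z) = z := by
  rw [← LinearMap.comp_apply, pull_comp_pull_of_comp_eq_id h k, LinearMap.id_apply]

/-- `σ ≫ τ = 𝟙 X ⇒ σ^* * τ^* = 1` in `Module.End ℚ Hᵏ(X(ℂ); ℚ)`. [cite: HatcherAT2002, §3.1 p. 198] -/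
theorem pull_mul_pull_of_comp_eq_id {σ τ : X ⟶ X} (h : σ ≫ τ = 𝟙 X) (k : ℕ) :
    pull σ k * pull τ k = 1 := by
  rw [Module.End.mul_eq_comp, pull_comp_pull_of_comp_eq_id h k, Module.End.one_eq_id]

/-- **`(σ^*)² = 1` for an involution `σ ≫ σ = 𝟙 X`**, in `Module.End ℚ Hᵏ(X(ℂ); ℚ)` — clause (i) of
the sign deck of `SignSymmetricPowers.VeryGeneralSignCommutatorsInHg` (`pull σ 3 ^ 2 = 1`).
[cite: HatcherAT2002, §3.1 p. 198] -/
theorem pull_sq_eq_one_of_comp_self_eq_id {σ : X ⟶ X} (h : σ ≫ σ = 𝟙 X) (k : ℕ) :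
    pull σ k ^ 2 = 1 := by
  rw [sq, pull_mul_pull_of_comp_eq_id h k]

/-- Mutually inverse morphisms over `ℂ` have isomorphic underlying scheme maps. [folklore] -/
private theorem isIso_left_of_comp_eq_id {σ τ : X ⟶ X} (h₁ : σ ≫ τ = 𝟙 X) (h₂ : τ ≫ σ = 𝟙 X) :
    IsIso σ.left :=
  ⟨τ.left, by rw [← Over.comp_left, h₁]; rfl, by rw [← Over.comp_left, h₂]; rfl⟩

/-- An involution `σ ≫ σ = 𝟙 X` has `σ.left` an isomorphism. [folklore] -/
private theorem isIso_left_of_comp_self_eq_id {σ : X ⟶ X} (h : σ ≫ σ = 𝟙 X) : IsIso σ.left :=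
  isIso_left_of_comp_eq_id h h

/-- **An involution is a trace isometry**: for `σ ≫ σ = 𝟙 X` on a smooth projective `X`,
`tr(σ^*x ∪ σ^*y) = tr(x ∪ y)` in all degrees (clause (ii) of the K1 sign deck at `i = j = 3`).
[cite: HatcherAT2002, §3.3 Thm. 3.26 and §3.2 Prop. 3.10] [cite: Fulton1998, Lemma 19.1.2 and §1.4] -/
theorem tr_cup_pull_pull (hX : IsSmoothProjective n X) {σ : X ⟶ X} (h : σ ≫ σ = 𝟙 X)
    (i j : ℕ) (x : bettiCohomology X i) (y : bettiCohomology X j) :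
    tr hX (i + j) (cup X i j (pull σ i x) (pull σ j y)) = tr hX (i + j) (cup X i j x y) := by
  haveI := isIso_left_of_comp_self_eq_id h
  exact tr_cup_pull_pull_of_isIso hX σ i j x y

/-- The same for a pair of mutually inverse morphisms (automorphisms of any order).
[cite: HatcherAT2002, §3.3 Thm. 3.26 and §3.2 Prop. 3.10] [cite: Fulton1998, Lemma 19.1.2 and §1.4] -/
theorem tr_cup_pull_pull_of_comp_eq_id (hX : IsSmoothProjective n X) {σ τ : X ⟶ X}
    (h₁ : σ ≫ τ = 𝟙 X) (h₂ : τ ≫ σ = 𝟙 X) (i j : ℕ) (x : bettiCohomology X i) (y : bettiCohomology X j) :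
    tr hX (i + j) (cup X i j (pull σ i x) (pull σ j y)) = tr hX (i + j) (cup X i j x y) := by
  haveI := isIso_left_of_comp_eq_id h₁ h₂
  exact tr_cup_pull_pull_of_isIso hX σ i j x y

/-- **Both deck clauses at once, in the shape of the K1 crux** (`n = 3`, `i = j = 3` there): an
involution `σ` of a smooth projective `X` satisfies `(σ^*)² = 1` on `Hᵏ(X(ℂ); ℚ)` and
`tr(σ^*x ∪ σ^*y) = tr(x ∪ y)` on `Hᵏ × Hᵏ`. [cite: HatcherAT2002, §3.3 Thm. 3.26 and Prop. 3.38] -/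
theorem pull_sq_eq_one_and_tr_cup_pull_pull (hX : IsSmoothProjective n X) {σ : X ⟶ X}
    (h : σ ≫ σ = 𝟙 X) (k : ℕ) :
    pull σ k ^ 2 = 1 ∧ ∀ x y : bettiCohomology X k,
      tr hX (k + k) (cup X k k (pull σ k x) (pull σ k y)) = tr hX (k + k) (cup X k k x y) :=
  ⟨pull_sq_eq_one_of_comp_self_eq_id h k, tr_cup_pull_pull hX h k k⟩

end HodgeTheory

end BettiUniverse

end Literature.AlgebraicGeometry.HodgeTheory

end
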